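/-
Copyright: see repository. [cite: CossartPiltant2008, Section 9, Lemma 9.4 (HAL p. 29 l. 48–49)]
-/
import Literature.AlgebraicGeometry.CossartPiltant200819.MonomialChartLift2008

/-!
# Cossart–Piltant 2008, Lemma 9.4 — node N2a′ carved: the localisation `S̄ ↦ S̄_{m_W ∩ S̄}` is
  PROVED; the monomial-chart leaf becomes a statement about the affine chart `S̄ = S[y]`

[CP-I] V. Cossart, O. Piltant, *Resolution of singularities of threefolds in positive
characteristic. I.*, J. Algebra **320** (2008) 1051–1082, HAL hal-00139124 (page/line locators
"HAL p. N l. M" refer to the HAL version, as in the rest of this directory).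

`MonomialChartLift2008` reduced the §9 monomial chart of Lemma 9.4 (HAL p. 29 l. 48–49:
"`S̄ := S[y₁, y₂, y₃]`. By (c), `S₁ := S̄_{m_W ∩ S̄}` is a local model of `W` and `S₁` is regular
by (b)") to the coefficient-free leaf `MonomialChartCentreSelf`, a statement about the LOCAL
ring `S₁`.  This file PROVES the passage from the affine chart `S̄ = S[y]` to its local ring
`S₁ = S̄_{m_W ∩ S̄}` and leaves the leaf

* `MonomialChartIdeal` (HYPOTHESIS, `G`-free, coefficient-free, localisation-free): the centre
  `𝔭 := m_W ∩ S̄` of `W` on the affine chart `S̄ := S[y]` is generated, as an ideal of `S̄`, by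
  the `y_i` of positive value together with `m = d - #{i | W(y_i) > 0}` values `P_j(y_{I₀})`
  of polynomials `P_j ∈ S[Y_{I₀}]` lying in `𝔭` — on paper: `m_S·S̄ ⊆ (y_{I₊})S̄` by (b), so
  `S̄/(y_{I₊})S̄` is a quotient of `κ(S)[Y_{I₀}]`, in which the image of `𝔭` is a maximal ideal
  (`S̄/𝔭 ⊆ κ(W)` is algebraic over `k`), generated by `#I₀` elements (maximal ideals of a
  polynomial ring in `n` variables over a field are `n`-generated);

and PROVES the glue `monomialChartCentreSelf_of_ideal : MonomialChartIdeal → MonomialChartCentreSelf`: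
`S₁ = S̄_𝔭` consists of the fractions `a/t`, `a, t ∈ S̄`, `W(t) = 0` (`locModel`), its maximal
ideal is `{W > 0} = 𝔭·S₁` (`mem_maximalIdeal_locModel_iff`), hence generated by the same
elements.

Re-threading (PROVED): node N2a, node N2, the Roots leaf of HAL p. 29 l. 14–65
(`tamePrimeDescentViaStableModelRoots_of_ideal`), Lemma 9.4 for inertial `W`, and the
directory's dependency statements with `MonomialChartIdeal` in place of `MonomialChartCentreSelf`.
-/

namespace Literature.AlgebraicGeometry.CossartPiltant200819.CP2008

open Literature.AlgebraicGeometry.Resolution IsLocalRing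
open scoped Pointwise

universe u

/-! ## The leaf: the centre of `W` on the affine chart `S̄ = S[y]` -/

section

/-- **Node N2a″ (HYPOTHESIS; `G`-free, coefficient-free, localisation-free).** [CP-I] Lemma 9.4,
HAL p. 29 l. 48–49: "`S̄ := S[y₁, y₂, y₃]`. By (c), `S₁ := S̄_{m_W ∩ S̄}` is a local model of `W`
and `S₁` is regular by (b)" — the affine part.  For a regular local model `S` of `W` (`κ(W)/k`
algebraic) with r.s.p. `x = (x_j)_{j < d}`, a unimodular `V` with inverse `C ≥ 0`, and
`y := x^V ⊆ W`: the centre `𝔭 := m_W ∩ S̄` of `W` on `S̄ := S[y]` (the `k`-subalgebra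
`S ⊔ k[y]` of `L`) is generated by the `y_i` with `W(y_i) > 0` together with `m` values
`P_j(y_{I₀})`, `I₀ := {i | W(y_i) = 0}`, of polynomials `P_j ∈ S[Y_{I₀}]` with
`W(P_j(y_{I₀})) > 0`, where `#{i | W(y_i) > 0} + m = d`.  On paper: by (b), `x = y^C` with
`C ≥ 0`, so `m_S·S̄ ⊆ (y_{I₊})S̄` and `S̄/(y_{I₊})S̄` is a quotient of `κ(S)[Y_{I₀}]`; the image
of `𝔭` there is a maximal ideal because `S̄/𝔭 ⊆ κ(W)` is generated over `κ(S)` by elements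
algebraic over `k`, hence it is generated by `#I₀` polynomials (maximal ideals of
`K'[Y₁, …, Y_n]` are `n`-generated), which lift to `S[Y_{I₀}]`.
[cite: CossartPiltant2008, Section 9, Lemma 9.4 (HAL p. 29 l. 48–49)] -/
def MonomialChartIdeal : Prop :=
  ∀ (k L : Type u) [Field k] [Field L] [Algebra k L]
    (W : ValuationSubring L) (hk : ∀ c : k, algebraMap k L c ∈ W), residueTrdeg k W hk = 0 →
    ∀ (S : Subalgebra k L) [IsRegularLocalRing S], IsLocalModelOf k L W S →
    ∀ (d : ℕ) (x : Fin d → L), (∀ j, x j ∈ S) →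
      Ideal.span {s : S | (s : L) ∈ Set.range x} = maximalIdeal S → ringKrullDim S = d →
    ∀ (V C : Matrix (Fin d) (Fin d) ℤ), V * C = 1 → (∀ i j, 0 ≤ C i j) →
    ∀ (y : Fin d → L), (∀ i, y i = ∏ j, x j ^ V i j) → (∀ i, y i ∈ W) →
      ∃ (m : ℕ) (P : Fin m → MvPolynomial {i : Fin d // W.valuation (y i) = 1} S),
        Fintype.card {i : Fin d // W.valuation (y i) < 1} + m = d ∧
        (∀ j, W.valuation (MvPolynomial.aeval
          (fun i : {i : Fin d // W.valuation (y i) = 1} => y i.1) (P j)) < 1) ∧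
        ∀ a : ↥(S ⊔ Algebra.adjoin k (Set.range y)), W.valuation (a : L) < 1 →
          a ∈ Ideal.span {s : ↥(S ⊔ Algebra.adjoin k (Set.range y)) |
            (s : L) ∈ y '' {i | W.valuation (y i) < 1} ∪
              Set.range (fun j => MvPolynomial.aeval
                (fun i : {i : Fin d // W.valuation (y i) = 1} => y i.1) (P j))}

end

/-! ## Node N2a′ from N2a″: localising at the centre (PROVED) -/

section Localisation

variable {k L : Type u} [Field k] [Field L] [Algebra k L] (W : ValuationSubring L)

/-- The maximal ideal of `B_{m_W ∩ B}` is generated by any set of elements of `m_W ∩ B` that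
generates `m_W ∩ B` inside `B` (HAL p. 4, local rings of `W` on models: `R = A_𝔭`,
`m_R = 𝔭A_𝔭`).
[cite: CossartPiltant2008, Section 3 (HAL p. 4, "Local rings and models")] -/
theorem span_eq_maximalIdeal_locModel_of_forall_mem_span {B : Subalgebra k L}
    (hBW : ∀ b ∈ B, b ∈ W) [IsLocalRing (locModel W B)] {T : Set L}
    (hTW : ∀ t ∈ T, W.valuation t < 1)
    (hgen : ∀ a : B, W.valuation (a : L) < 1 → a ∈ Ideal.span {s : B | (s : L) ∈ T}) :
    Ideal.span {s : locModel W B | (s : L) ∈ T} = maximalIdeal (locModel W B) := by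
  classical
  refine le_antisymm (Ideal.span_le.mpr fun s hs =>
    (mem_maximalIdeal_locModel_iff W B hBW s).mpr (hTW _ hs)) fun s hs => ?_
  have hvs : W.valuation (s : L) < 1 := (mem_maximalIdeal_locModel_iff W B hBW s).mp hs
  obtain ⟨a, ha, t, ht, hvt, hst⟩ := (mem_locModel_iff W B).mp s.2
  have ht0 : t ≠ 0 := fun h0 => by
    rw [h0, map_zero] at hvt
    exact zero_ne_one hvt
  have hva : W.valuation a < 1 := by
    have h1 : a = (s : L) * t := by rw [hst, inv_mul_cancel_right₀ ht0]
    rw [h1, map_mul, hvt, mul_one]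
    exact hvs
  have hle : Ideal.span {s : B | (s : L) ∈ T} ≤
      Ideal.comap (Subalgebra.inclusion (le_locModel W B))
        (Ideal.span {s : locModel W B | (s : L) ∈ T}) := by
    rw [Ideal.span_le]
    intro b hb
    rw [SetLike.mem_coe, Ideal.mem_comap]
    exact Ideal.subset_span hb
  have hmem : Subalgebra.inclusion (le_locModel W B) ⟨a, ha⟩ ∈
      Ideal.span {s : locModel W B | (s : L) ∈ T} := hle (hgen ⟨a, ha⟩ hva)
  have hseq : s = Subalgebra.inclusion (le_locModel W B) ⟨a, ha⟩ *
      ⟨t⁻¹, inv_mem_locModel W B (le_locModel W B ht) hvt⟩ :=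
    Subtype.ext (by rw [MulMemClass.coe_mul, Subalgebra.coe_inclusion]; exact hst)
  rw [hseq]
  exact Ideal.mul_mem_right _ _ hmem

end Localisation

/-- **Node N2a′ PROVED from N2a″.** [CP-I] Lemma 9.4, HAL p. 29 l. 48: "`S₁ := S̄_{m_W ∩ S̄}`":
generators of the centre `𝔭 = m_W ∩ S̄` of `W` on the affine chart generate the maximal ideal
`𝔭S₁` of the local ring `S₁ = S̄_𝔭` (`span_eq_maximalIdeal_locModel_of_forall_mem_span`); `S₁`
is a local ring because `S̄ ⊆ W` (`isLocalRing_locModel`).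
[cite: CossartPiltant2008, Section 9, Lemma 9.4 (HAL p. 29 l. 48–49)] -/
theorem monomialChartCentreSelf_of_ideal (h : MonomialChartIdeal.{u}) :
    MonomialChartCentreSelf.{u} := by
  intro k L _ _ _ W hk hres S hSreg hS d x hxS hspanx hdimS V C hVC hC y hy hyW
  classical
  obtain ⟨m, P, hcard, hPval, hgen⟩ := h k L W hk hres S hS d x hxS hspanx hdimS V C hVC hC y hy hyW
  have hyW' : Set.range y ⊆ (valuationSubalgebra W hk : Set L) := by
    rintro _ ⟨i, rfl⟩
    exact hyW i
  have hAW : ∀ a ∈ S ⊔ Algebra.adjoin k (Set.range y), a ∈ W := fun a ha =>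
    (sup_le (fun s hs => hS.mem_of_mem hs) (Algebra.adjoin_le hyW') :
      S ⊔ Algebra.adjoin k (Set.range y) ≤ valuationSubalgebra W hk) ha
  haveI hloc : IsLocalRing (locModel W (S ⊔ Algebra.adjoin k (Set.range y))) :=
    isLocalRing_locModel W _ hAW
  refine ⟨m, P, hloc, hcard, span_eq_maximalIdeal_locModel_of_forall_mem_span W hAW ?_ hgen⟩
  rintro _ (⟨i, hi, rfl⟩ | ⟨j, rfl⟩)
  · exact hi
  · exact hPval j

/-! ## Re-threading through the localisation-free leaf -/

section Rethreaded

/-- **Node N2a `MonomialChartCentre` from N2a″** (`monomialChartCentre_of_self` ∘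
`monomialChartCentreSelf_of_ideal`).
[cite: CossartPiltant2008, Section 9, Lemma 9.4 (HAL p. 29 l. 48–59)] -/
theorem monomialChartCentre_of_ideal (h : MonomialChartIdeal.{u}) : MonomialChartCentre.{u} :=
  monomialChartCentre_of_self (monomialChartCentreSelf_of_ideal h)

/-- **Node N2 `MonomialChartRegular` from N2a″.**
[cite: CossartPiltant2008, Section 9, Lemma 9.4 (HAL p. 29 l. 48–59)] -/
theorem monomialChartRegular_of_ideal (h : MonomialChartIdeal.{u}) : MonomialChartRegular.{u} :=
  monomialChartRegular_of_self (monomialChartCentreSelf_of_ideal h)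

/-- **The Roots leaf of Lemma 9.4 from the single localisation-free, coefficient-free, `G`-free
leaf `MonomialChartIdeal`.**
[cite: CossartPiltant2008, Lemma 9.4 proof (HAL p. 29, l. 14–65)] -/
theorem tamePrimeDescentViaStableModelRoots_of_ideal (h : MonomialChartIdeal.{u}) :
    TamePrimeDescentViaStableModelRoots.{u} :=
  tamePrimeDescentViaStableModelRoots_of_self (monomialChartCentreSelf_of_ideal h)

/-- **Lemma 9.4 from Cor. 6.3, Prop. 9.3, the localisation-free monomial-chart leaf and (S3\*)
for inertial `W`.**
[cite: CossartPiltant2008, Lemma 9.4 (HAL pp. 28–29)] -/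
theorem tamePrimeDescent_of_ideal_of_inertia (h63 : ClimbToInertiaField.{u})
    (h93 : DescentBelowInertiaField.{u}) (n : MonomialChartIdeal.{u})
    (h₂ : GStableUniformizationInertial.{u}) : TamePrimeDescent.{u} :=
  tamePrimeDescent_of_self_of_inertia h63 h93 (monomialChartCentreSelf_of_ideal n) h₂

/-- **[CP-I] Thm. 2.1 VERBATIM for reduced quasi-projective threefolds —
`resolutionQuasiProjectiveThreefolds_of_printedLeaves_residuals_self` with node N2a′ reduced to
the localisation-free leaf.**
[cite: CossartPiltant2008, Thm 2.1 (HAL p. 3)] [cite: CossartPiltant2009, Theorem (p. 1839)]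
[cite: CossartJannsenSaito2020, Introduction Thm. 1, Thm. 1.2] -/
theorem resolutionQuasiProjectiveThreefolds_of_printedLeaves_residuals_ideal
    (h49 : RefinedPatchingQuasiProjective.{u}) (hP : CossartPiltant2019Principalization.{u})
    (h83 : PrimeDegreeAscent.{u}) (h93 : DescentBelowInertiaField.{u})
    (n : MonomialChartIdeal.{u})
    (hFu : PrimaryTransformRankOne.{u}) (hBPR : BenitoPiltantReguera2022QuadraticSequence.{u})
    (hnd : GStableUniformizationInertialRankOneNonDiscrete.{u})
    (hdi : GStableUniformizationInertialRankOneDiscreteImperfect.{u})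
    (cp2 : CossartPiltant2009Main.{u}) (hE : CossartJannsenSaito2020Embedded.{u})
    (h36 : CossartJannsenSaito2020Sequence.{u}) : ResolutionQuasiProjectiveThreefolds.{u} :=
  resolutionQuasiProjectiveThreefolds_of_printedLeaves_residuals_self h49 hP h83 h93
    (monomialChartCentreSelf_of_ideal n) hFu hBPR hnd hdi cp2 hE h36

/-- **Both halves of the 2008 programme's top statement —
`cp2008_of_printedLeaves_residuals_self` with node N2a′ reduced to the localisation-free leaf.**
[cite: CossartPiltant2008, Thm 2.1 and Thm 7.2 (HAL pp. 3–4)] [cite: CossartPiltant2009, Theorem (p. 1839)]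
[cite: CossartJannsenSaito2020, Thm. 1.2] -/
theorem cp2008_of_printedLeaves_residuals_ideal (p49 : RefinedPatching.{u})
    (hP : CossartPiltant2019Principalization.{u}) (h83 : PrimeDegreeAscent.{u})
    (h93 : DescentBelowInertiaField.{u}) (n : MonomialChartIdeal.{u})
    (hFu : PrimaryTransformRankOne.{u})
    (hBPR : BenitoPiltantReguera2022QuadraticSequence.{u})
    (hnd : GStableUniformizationInertialRankOneNonDiscrete.{u})
    (hdi : GStableUniformizationInertialRankOneDiscreteImperfect.{u})
    (cp2 : CossartPiltant2009Main.{u}) (h36 : CossartJannsenSaito2020General.{u})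
    (p41 : CossartJannsenSaito2020Embedded.{u}) :
    ResolutionAffineThreefolds.{u} ∧ LU3DiffFinite.{u} :=
  cp2008_of_printedLeaves_residuals_self p49 hP h83 h93 (monomialChartCentreSelf_of_ideal n)
    hFu hBPR hnd hdi cp2 h36 p41

/-- **[CP-I] Thm. 2.1 in universe `0` with the discrete-imperfect residual reduced to its core via
Knaf–Kuhlmann — `resolutionQuasiProjectiveThreefolds_of_printedLeaves_residuals₀_self` with node
N2a′ reduced to the localisation-free leaf.**
[cite: CossartPiltant2008, Thm 2.1 (HAL p. 3)] [cite: KnafKuhlmann2009, Thm. 1.5]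
[cite: CossartJannsenSaito2020, Introduction Thm. 1, Thm. 1.2] -/
theorem resolutionQuasiProjectiveThreefolds_of_printedLeaves_residuals₀_ideal
    (h49 : RefinedPatchingQuasiProjective.{0}) (hP : CossartPiltant2019Principalization.{0})
    (h83 : PrimeDegreeAscent.{0}) (h93 : DescentBelowInertiaField.{0})
    (n : MonomialChartIdeal.{0})
    (hFu : PrimaryTransformRankOne.{0}) (hKK : KnafKuhlmann2009MonogenicCompletion)
    (hBPR : BenitoPiltantReguera2022QuadraticSequence.{0})
    (hnd : GStableUniformizationInertialRankOneNonDiscrete.{0})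
    (hdic : GStableUniformizationInertialRankOneDiscreteImperfectCore)
    (cp2 : CossartPiltant2009Main.{0}) (hE : CossartJannsenSaito2020Embedded.{0})
    (h36 : CossartJannsenSaito2020Sequence.{0}) : ResolutionQuasiProjectiveThreefolds.{0} :=
  resolutionQuasiProjectiveThreefolds_of_printedLeaves_residuals₀_self h49 hP h83 h93
    (monomialChartCentreSelf_of_ideal n) hFu hKK hBPR hnd hdic cp2 hE h36

end Rethreaded

end Literature.AlgebraicGeometry.CossartPiltant200819.CP2008
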